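import Mathlib
import Literature.Analysis.FluidPDE.LoopCirculation
import Literature.Analysis.FluidPDE.ClassicalSolution
import Summits.NavierStokesRegularity.NavierStokesRegularity.Theorems.TautLoopKelvinTautLoopLawStepSlabDeluxeTools
import Summits.NavierStokesRegularity.NavierStokesRegularity.Theorems.TautLoopKelvinTautLoopLawStepLoopSideTools
import Summits.NavierStokesRegularity.NavierStokesRegularity.Theorems.TautLoopKelvinTautLoopLawWalkSelectionAux
import Summits.NavierStokesRegularity.NavierStokesRegularity.Theorems.TautLoopKelvinTautLoopLawWalkSelectionAux3
import Summits.NavierStokesRegularity.NavierStokesRegularity.Theorems.TautLoopKelvinTautLoopLawWalkSelectionAux4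
import HarnessLib

/-!
# Route `TautLoopKelvin`, crux `TautLoopLaw` (stmt-NavierStokesRegularity-15249), line
  `Sketch-ideas-r1k1` (Dini–Saks architecture) — skeleton stub 6A `stub_tautLoopWalkSelection`

**Random-walk Kelvin selection.** For a classical Leray–Hopf solution from a rapidly decaying
datum on `[0, T)`, a base time `t ∈ (0, T)`, a confinement radius `R`, a length budget `L`, a
slack `δ > 0` and any exponent `M`, there is `h₀ > 0` such that for every `h ∈ (0, h₀)` every
closed `C¹` loop `γ` in the closed `R`-ball with `len γ ≤ L` has a closed `C¹` partner `γ'` in the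
`(R+1)`-ball with `len γ' ≤ len γ · exp(h (κ(γ) + δ))` (`κ` the mean tangential compression of
`γ` in the slice `u t`) and `|∮_γ u(t)| − h^M ≤ |∮_{γ'} u(t − h)|`.

Assembly of the landed tools of the line:

* slab constants `B₀, …, B₄, Bt` on `[t/2, t]` (`tautLoopSlabD_bounds`), and the per-slab
  construction of the scheme on `[t − h, t]` with `n = n(h)` sub-steps — backward flows, scheme
  fields, splitting remainder modulo a gradient (`stub_tautLoopWalk6AAux3`, from
  `stub_tautLoopStepFlowExistsTools`, `stub_tautLoopStepFlowTaylorTools`,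
  `stub_tautLoopStepSplittingTools`);
* thresholds: every smallness requirement is an eventual property at `0⁺` depending only on
  the constants (`stub_tautLoopWalk6AAux`), and `h₀` is extracted at the end; the tail radius is
  `λ = h^{1/3}` and `n = ⌈2 L K₂ h² / h^M⌉ + 1`;
* the per-loop assembly (`stub_tautLoopWalk6AAux4`: circulation of the scheme as an average over
  `6ⁿ` deformed loops, tail count of the lazy walk, bulk length and confinement estimates,
  first-moment selection), applied to `γ` if `∮_γ u(t) ≥ 0` and to the reversed loop otherwise
  (`tautLoopLoop_reverse`).

Folklore (P. Constantin, G. Iyer, *Comm. Pure Appl. Math.* 61 (2008), Prop. 2.10, in continuum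
form; A. J. Majda, A. L. Bertozzi, *Vorticity and Incompressible Flow* (2002), §1.6, §3.4).
-/

noncomputable section

open Set Function Filter Topology MeasureTheory intervalIntegral Literature.Analysis.FluidPDE
open scoped InnerProductSpace RealInnerProductSpace

namespace Summit.NavierStokesRegularity.NavierStokesRegularity.Theorems

set_option linter.dupNamespace false

local notation3 "E3" => EuclideanSpace ℝ (Fin 3)

/-- **Orientation (WLOG `∮_γ v ≥ 0`).** If the selection works for loops with nonnegative
circulation, it works for every loop: apply it to the reversed loop `σ ↦ γ(1 − σ)`, which is a
closed `C¹` loop through the same points with the same length and the same compression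
numerator and with the opposite circulation (`tautLoopLoop_reverse`). [folklore] -/
theorem tautLoopWalk6A_wlog (v w : E3 → E3) (R L e h δ : ℝ) (hv : ContDiff ℝ 1 v)
    (core : ∀ γ : ℝ → E3, IsC1Loop γ → (∀ σ, ‖γ σ‖ ≤ R) →
      (∫ σ in (0:ℝ)..1, ‖deriv γ σ‖) ≤ L → 0 ≤ circulation v γ →
      ∃ γ' : ℝ → E3, IsC1Loop γ' ∧ (∀ σ, ‖γ' σ‖ ≤ R + 1) ∧
      (∫ σ in (0:ℝ)..1, ‖deriv γ' σ‖) ≤ (∫ σ in (0:ℝ)..1, ‖deriv γ σ‖) * Real.exp (h *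
        (((∫ σ in (0:ℝ)..1, -(inner ℝ (deriv γ σ) (fderiv ℝ v (γ σ) (deriv γ σ))) /
          ‖deriv γ σ‖) / (∫ σ in (0:ℝ)..1, ‖deriv γ σ‖)) + δ)) ∧
      circulation v γ - e ≤ |circulation w γ'|)
    (γ : ℝ → E3) (hγ : IsC1Loop γ) (hγR : ∀ σ, ‖γ σ‖ ≤ R)
    (hγL : (∫ σ in (0:ℝ)..1, ‖deriv γ σ‖) ≤ L) :
    ∃ γ' : ℝ → E3, IsC1Loop γ' ∧ (∀ σ, ‖γ' σ‖ ≤ R + 1) ∧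
      (∫ σ in (0:ℝ)..1, ‖deriv γ' σ‖) ≤ (∫ σ in (0:ℝ)..1, ‖deriv γ σ‖) * Real.exp (h *
        (((∫ σ in (0:ℝ)..1, -(inner ℝ (deriv γ σ) (fderiv ℝ v (γ σ) (deriv γ σ))) /
          ‖deriv γ σ‖) / (∫ σ in (0:ℝ)..1, ‖deriv γ σ‖)) + δ)) ∧
      |circulation v γ| - e ≤ |circulation w γ'| := by
  rcases le_or_gt 0 (circulation v γ) with hΓ | hΓ
  · obtain ⟨γ', h1, h2, h3, h4⟩ := core γ hγ hγR hγL hΓ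
    exact ⟨γ', h1, h2, h3, by rwa [abs_of_nonneg hΓ]⟩
  · obtain ⟨hγr, hlenr, hcircr, hcompr⟩ := tautLoopLoop_reverse hγ
    have hΓr : 0 ≤ circulation v (fun s => γ (1 - s)) := by
      rw [hcircr v hv.continuous]
      exact (neg_pos.2 hΓ).le
    obtain ⟨γ', h1, h2, h3, h4⟩ :=
      core (fun s => γ (1 - s)) hγr (fun σ => hγR _) (by rw [hlenr]; exact hγL) hΓr
    refine ⟨γ', h1, h2, ?_, ?_⟩
    · beta_reduce at h3
      rw [hlenr, hcompr v hv] at h3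
      exact h3
    · rw [hcircr v hv.continuous] at h4
      rw [abs_of_neg hΓ]
      exact h4

/-- **Skeleton stub 6A `stub_tautLoopWalkSelection` — random-walk Kelvin selection**
(registered signature, verbatim): for the crux class, `t ∈ (0, T)`, a radius `R`, a length
budget `L`, a slack `δ > 0` and any exponent `M`, there is `h₀ > 0` such that every closed `C¹`
loop in the `R`-ball of length `≤ L` has, for every `h ∈ (0, h₀)`, a closed `C¹` partner in the
`(R+1)`-ball with `len γ' ≤ len γ · exp(h(κ(γ) + δ))` and `|∮_γ u(t)| − h^M ≤ |∮_{γ'} u(t−h)|`.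
Finite random-walk Kelvin splitting (six-point average then exact transport by the backward
flow, `n(h)` sub-steps), circulation of the scheme as an average over `6ⁿ` deformed loops,
super-polynomially few paths leave the `h^{1/3}`-ball, a mean is at most a max, and the
first-order length bound on the bulk. [folklore] -/
theorem stub_tautLoopWalkSelection : ∀ (ν T : ℝ), 0 < ν → 0 < T → ∀ (u : ℝ → EuclideanSpace ℝ (Fin 3) → EuclideanSpace ℝ (Fin 3)) (p : ℝ → EuclideanSpace ℝ (Fin 3) → ℝ), Literature.Analysis.FluidPDE.IsClassicalNSSolutionOn (Set.Ico 0 T) ν 0 u p → Literature.Analysis.FluidPDE.IsLerayHopfOn T ν 0 (u 0) u → Literature.Analysis.FluidPDE.HasRapidSpatialDecay (u 0) → ∀ t : ℝ, 0 < t → t < T → ∀ R L δ : ℝ, ∀ M : ℕ, 0 < R → 0 < L → 0 < δ → ∃ h₀ : ℝ, 0 < h₀ ∧ ∀ h : ℝ, 0 < h → h < h₀ → ∀ γ : ℝ → EuclideanSpace ℝ (Fin 3), Literature.Analysis.FluidPDE.IsC1Loop γ → (∀ σ, ‖γ σ‖ ≤ R) → (∫ σ in (0:ℝ)..1, ‖deriv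 γ σ‖) ≤ L → ∃ γ' : ℝ → EuclideanSpace ℝ (Fin 3), Literature.Analysis.FluidPDE.IsC1Loop γ' ∧ (∀ σ, ‖γ' σ‖ ≤ R + 1) ∧ (∫ σ in (0:ℝ)..1, ‖deriv γ' σ‖) ≤ (∫ σ in (0:ℝ)..1, ‖deriv γ σ‖) * Real.exp (h * (((∫ σ in (0:ℝ)..1, -(inner ℝ (deriv γ σ) (fderiv ℝ (u t) (γ σ) (deriv γ σ))) / ‖deriv γ σ‖) / (∫ σ in (0:ℝ)..1, ‖deriv γ σ‖)) + δ)) ∧ |Literature.Analysis.FluidPDE.circulation (u t) γ| - h ^ M ≤ |Literature.Analysis.FluidPDE.circulation (u (t - h)) γ'| := by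
  intro ν T hν hT u p hcl hLH hdec t ht htT R L δ M _hR hL hδ
  -- (A) slab constants on `[t/2, t]`
  have ht2 : 0 < t / 2 := half_pos ht
  have ht2t : t / 2 < t := half_lt_self ht
  obtain ⟨hBn, Bt, hBt, hut, hDut, hD2ut⟩ := tautLoopSlabD_bounds hν hT hcl hLH hdec ht2 ht2t htT
  obtain ⟨B₀, hB₀, hu0'⟩ := hBn 0
  obtain ⟨B₁, hB₁, hu1'⟩ := hBn 1
  obtain ⟨B₂, hB₂, hu2⟩ := hBn 2
  obtain ⟨B₃, hB₃, hu3⟩ := hBn 3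
  obtain ⟨B₄, hB₄, hu4⟩ := hBn 4
  have hu0 : ∀ s ∈ Set.Icc (t / 2) t, ∀ x, ‖u s x‖ ≤ B₀ := fun s hs x => by
    rw [← norm_iteratedFDeriv_zero (𝕜 := ℝ)]
    exact hu0' s hs x
  have hu1 : ∀ s ∈ Set.Icc (t / 2) t, ∀ x, ‖fderiv ℝ (u s) x‖ ≤ B₁ := fun s hs x => by
    rw [← norm_iteratedFDeriv_one (𝕜 := ℝ)]
    exact hu1' s hs x
  obtain ⟨K₁, K₂, hK₁, hK₂, hcons⟩ :=
    stub_tautLoopWalk6AAux3 ν B₀ B₁ B₂ B₃ B₄ Bt hν hB₀ hB₁ hB₂ hB₃ hB₄ hBt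
  -- (0) thresholds, as eventual properties at `0⁺`
  have h36 : (0 : ℝ) < 36 * ν := by positivity
  have hev : ∀ᶠ h in nhdsWithin (0:ℝ) (Set.Ioi 0), h < t / 2 ∧ h < 1 ∧
      B₁ * h + 0 * h ^ (1 / 3 : ℝ) ≤ 1 ∧ K₁ * h + 2 * h ^ (1 / 3 : ℝ) ≤ 1 ∧
      (Real.exp (B₁ + K₁) * ((B₁ + K₁) ^ 2 + K₁) + B₂ * K₁ + Bt + B₁ ^ 2) * h +
        2 * B₂ * h ^ (1 / 3 : ℝ) ≤ δ ∧
      24 * (B₀ * Real.exp (B₁ + K₁) * L) * Real.exp (-(1 / (36 * ν * h ^ (1 / 3 : ℝ)))) ≤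
        (h ^ (1 / 3 : ℝ)) ^ (3 * M) ∧
      13 * Real.exp (-(1 / (36 * ν * h ^ (1 / 3 : ℝ)))) ≤ (h ^ (1 / 3 : ℝ)) ^ 0 := by
    filter_upwards [tautLoopWalk6A_eventually_lt (t / 2) ht2, tautLoopWalk6A_eventually_lt 1
      one_pos, tautLoopWalk6A_eventually_affine B₁ 0 1 one_pos,
      tautLoopWalk6A_eventually_affine K₁ 2 1 one_pos,
      tautLoopWalk6A_eventually_affine
        (Real.exp (B₁ + K₁) * ((B₁ + K₁) ^ 2 + K₁) + B₂ * K₁ + Bt + B₁ ^ 2) (2 * B₂) δ hδ,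
      tautLoopWalk6A_eventually_tail (36 * ν) (24 * (B₀ * Real.exp (B₁ + K₁) * L)) (3 * M) h36,
      tautLoopWalk6A_eventually_tail (36 * ν) 13 0 h36] with h h1 h2 h3 h4 h5 h6 h7
    exact ⟨h1, h2, h3, h4, h5, h6, h7⟩
  obtain ⟨h₀, hh₀, hP⟩ := tautLoopWalk6A_exists_h0 _ hev
  refine ⟨h₀, hh₀, ?_⟩
  intro h hh hhh₀
  obtain ⟨e1, e2, e3, e4, e5, e6, e7⟩ := hP h hh hhh₀
  have hhB₁ : h * B₁ ≤ 1 := by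
    rw [mul_comm]
    simpa using e3
  -- (B) the per-`h` construction on `[t - h, t]`
  have hlam0 : 0 < h ^ (1 / 3 : ℝ) := Real.rpow_pos_of_pos hh _
  have hlam3 : (h ^ (1 / 3 : ℝ)) ^ 3 = h := by
    rw [← Real.rpow_natCast, ← Real.rpow_mul hh.le]
    norm_num
  obtain ⟨n, hn⟩ : ∃ n : ℕ, n = ⌈2 * L * K₂ * h ^ 2 / h ^ M⌉₊ + 1 := ⟨_, rfl⟩
  have hn0 : 0 < n := by rw [hn]; exact Nat.succ_pos _
  have hn0' : (0 : ℝ) < n := Nat.cast_pos.2 hn0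
  have hnτ : (n : ℝ) * (h / n) = h := by field_simp
  have hτ0 : 0 < h / n := div_pos hh hn0'
  have ha0 : 0 < Real.sqrt (6 * ν * (h / n)) := Real.sqrt_pos.2 (by positivity)
  have ha2 : Real.sqrt (6 * ν * (h / n)) ^ 2 = 6 * ν * (h / n) := Real.sq_sqrt (by positivity)
  have heb : K₂ * h ^ 2 / n * L ≤ h ^ M / 2 := by
    have hx : 2 * L * K₂ * h ^ 2 / h ^ M ≤ n := by
      rw [hn]
      push_cast
      exact (Nat.le_ceil _).trans (le_add_of_nonneg_right zero_le_one)
    rw [div_le_iff₀ (pow_pos hh M)] at hx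
    rw [div_mul_eq_mul_div, div_le_iff₀ hn0']
    linarith
  have hsubI : Set.Icc (t - h) t ⊆ Set.Icc (t / 2) t := Set.Icc_subset_Icc (by linarith) le_rfl
  have hsub0 : Set.Icc (t - h) t ⊆ Set.Ico 0 T := fun s hs =>
    ⟨by linarith [hs.1], lt_of_le_of_lt hs.2 htT⟩
  have hNS : IsClassicalNSSolutionOn (Set.Icc (t - h) t) ν 0 u p :=
    hcl.mono hsub0 (uniqueDiffOn_Icc (by linarith))
  obtain ⟨A, θ, Q, hA, hAd, hAT, hDfT, hθc, hθ0, hθrec, hQ, hrem⟩ := hcons u p (t - h) t n hn0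
    (by linarith) (by linarith) hNS (fun r hr => hu0 r (hsubI hr)) (fun r hr => hu1 r (hsubI hr))
    (fun r hr => hu2 r (hsubI hr)) (fun r hr => hu3 r (hsubI hr)) (fun r hr => hu4 r (hsubI hr))
    (fun r hr r' hr' => hut r (hsubI hr) r' (hsubI hr'))
    (fun r hr r' hr' => hDut r (hsubI hr) r' (hsubI hr'))
    (fun r hr r' hr' => hD2ut r (hsubI hr) r' (hsubI hr'))
  have hba : t - (t - h) = h := by ring
  simp only [hba] at hAd hAT hDfT hθrec hrem
  -- the slices at `t - h`, `t` and at the sub-interval end-points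
  have htI : t ∈ Set.Icc (t / 2) t := ⟨ht2t.le, le_rfl⟩
  have hthI : t - h ∈ Set.Icc (t / 2) t := ⟨by linarith, by linarith⟩
  have hf₀c : Continuous (u (t - h)) := (hcl.smooth_velocity.contDiff_slice (hsub0
    ⟨le_rfl, by linarith⟩)).continuous
  have hf₁ : ContDiff ℝ 1 (u t) := (hcl.smooth_velocity.contDiff_slice ⟨ht.le, htT⟩).of_le
    (by norm_cast)
  have hmem : ∀ k : ℕ, k < n → t - h + ((k : ℝ) + 1) * (h / n) ∈ Set.Icc (t / 2) t := by
    intro k hk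
    have hk1 : (k : ℝ) + 1 ≤ n := by exact_mod_cast hk
    have h1 : ((k : ℝ) + 1) * (h / n) ≤ n * (h / n) :=
      mul_le_mul_of_nonneg_right hk1 hτ0.le
    rw [hnτ] at h1
    have h2 : 0 ≤ ((k : ℝ) + 1) * (h / n) := by positivity
    constructor <;> linarith
  -- the per-loop core
  have core : ∀ γ : ℝ → E3, IsC1Loop γ → (∀ σ, ‖γ σ‖ ≤ R) →
      (∫ σ in (0:ℝ)..1, ‖deriv γ σ‖) ≤ L → 0 ≤ circulation (u t) γ →
      ∃ γ' : ℝ → E3, IsC1Loop γ' ∧ (∀ σ, ‖γ' σ‖ ≤ R + 1) ∧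
      (∫ σ in (0:ℝ)..1, ‖deriv γ' σ‖) ≤ (∫ σ in (0:ℝ)..1, ‖deriv γ σ‖) * Real.exp (h *
        (((∫ σ in (0:ℝ)..1, -(inner ℝ (deriv γ σ) (fderiv ℝ (u t) (γ σ) (deriv γ σ))) /
          ‖deriv γ σ‖) / (∫ σ in (0:ℝ)..1, ‖deriv γ σ‖)) + δ)) ∧
      circulation (u t) γ - h ^ M ≤ |circulation (u (t - h)) γ'| :=
    fun γ hγ hγR hγL hΓ => stub_tautLoopWalk6AAux4 ν n M (h / n) h (h ^ (1 / 3 : ℝ))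
      (Real.sqrt (6 * ν * (h / n))) K₁ B₀ B₁ B₂ Bt (K₂ * h ^ 2 / n) L R δ (u (t - h)) (u t) A
      (fun k y => fderiv ℝ (u (t - h + (k + 1) * (h / n))) y) θ Q γ hν hn0 hτ0 hnτ e2.le hlam0
      hlam3 ha0 ha2 hK₁ hB₀ hB₁ hB₂ hBt hf₀c (fun x => hu0 _ hthI x) hf₁ (fun x => hu1 _ htI x)
      hA hAd hAT (fun k hk y => hu1 _ (hmem k hk) y) hDfT hθc hθ0 hθrec hQ hrem heb hhB₁ e4 e5
      e6 e7 hγ hγR hγL hΓ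
  -- orientation
  intro γ hγ hγR hγL
  exact tautLoopWalk6A_wlog (u t) (u (t - h)) R L (h ^ M) h δ hf₁ core γ hγ hγR hγL

end Summit.NavierStokesRegularity.NavierStokesRegularity.Theorems

end
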